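import Summits.CriticalPhenomena.PercolationContinuityZ3.Theorems.FK.NoLatentHeat
import Summits.CriticalPhenomena.PercolationContinuityZ3.Theorems.FK.PressureBetaCoexistence
import Literature.Probability.LatticeModels.PlanarIsingCriticalBeta
import HarnessLib

/-!
# IN TWO DIMENSIONS THE ZERO-FIELD PRESSURE IS `C¹` IN `β` ON ALL OF `(0,∞)` — NO `β`-KINK AT ANY TEMPERATURE
# (Benettin–Gallavotti–Jona-Lasinio–Stella 1973, eq. (3.10); Lebowitz 1977, Thm. 2; Onsager–Yang)

Claimed R42 (8)(c) in the cell INBOX at 2026-08-29T02:06:42Z by fkp-10a gen 357 (NEW CLAIM #4 of the gen), addressed to coordinator fk-4 gen 288 (seated 01:00Z 2026-08-29 by l.8634; R160 / R161 / R162 in force); lineage row FO-10a-g357p2 (self-suggested), package g357-planar, label PL-A.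
Helper file of the `fk-continuity` build cell (bschramm lane; `--supports stmt-CriticalPhenomena-4575`); builds on
p205010 (kernel theorem, internal audit signed; external expert review pending). No definitions, no named facts, no
sorries; standard axioms. UNCONDITIONAL (nearest-neighbour Ising model on `ℤ²`, `β > 0`, zero field).

In `d = 2` the tree PROVES (Kramers–Wannier duality with the Onsager–Toeplitz analysis, BGJS eq. (3.10)) that the free and
plus two-point functions agree above `β_c(2)`: `twoPointFree_eq_twoPointPlus_of_criticalBetaTwo_lt_holds`
(`PlanarIsingCriticalBeta`), and `criticalBeta 2 = criticalBetaTwo = ½ log(1+√2)` (`criticalBeta_two_holds`). Together with the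
uniqueness for `β ≤ β_c` this gives `⟨σ_0σ_{eᵢ}⟩^∅_β = ⟨σ_0σ_{eᵢ}⟩⁺_β` for EVERY `β > 0`, hence by the one-sided
`β`-derivatives of `PressureBetaDerivative` (Lebowitz Thm. 2):

* `nn_freeCorr_eq_plusCorr_two_of_pos` — for every `β > 0` and `i`, `⟨σ_0σ_{eᵢ}⟩^∅_{β,0} = ⟨σ_0σ_{eᵢ}⟩⁺_{β,0}` on `ℤ²`
  (the `β > β_c(2)` case is the tree's `nn_freeCorr_eq_plusCorr_two`, `AizenmanHiguchiFromInvariance`; the pair-function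
  conversions are the tree's `twoPointFree_eq_freeCorr` / `twoPointPlus_eq_plusCorr`, `SharpnessProofs`);
* **`hasDerivAt_pressure_beta_two`** — **for EVERY `β > 0`, `HasDerivAt ψ₂(·,0) (Σᵢ ⟨σ_0σ_{eᵢ}⟩⁺_β) β`**: the planar
  zero-field pressure has no kink in `β` at any temperature (the energy density is continuous through `β_c` and through
  the whole low-temperature phase); `differentiableOn_pressure_beta_two`;
* `continuousAt_sum_plusCorr_nn_two`, **`continuousOn_deriv_pressure_beta_two`** — the energy `β ↦ Σᵢ ⟨σ_0σ_{eᵢ}⟩⁺_β` is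
  continuous on `(0,∞)` and `ψ₂(·,0) ∈ C¹((0,∞))`;
* `nn_spinCorr_eq_plusCorr_two` — every translation invariant `μ ∈ 𝒢(β,0)` on `ℤ²` has the plus nearest-neighbour energy
  at EVERY `β > 0` (Lebowitz Thm. 2 via differentiability; the mixture statement for `β > β_c(2)`, Lebowitz Thm. 3, is the
  tree's `Literature.Probability.LatticeModels.translationInvariant_eq_mixture_two` and is not restated).

## References

* G. Benettin, G. Gallavotti, G. Jona-Lasinio, A. L. Stella, *On the Onsager–Yang value of the spontaneous magnetization*,
  Comm. Math. Phys. 30 (1973) 45–54, eq. (3.10). [BenettinGallavottiJonaLasinioStella1973]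
* J. L. Lebowitz, *Coexistence of phases in Ising ferromagnets*, J. Stat. Phys. 16 (1977) 463–476, §3, Thm. 2.
  [Lebowitz1977]
* S. Friedli, Y. Velenik, *Statistical Mechanics of Lattice Systems*, CUP (2017), §3.10.1 and Thm. 3.25. [FriedliVelenik2017]
-/

noncomputable section

namespace Summit.CriticalPhenomena.PercolationContinuityZ3.Theorems.FK

namespace IsingEnergyDensity

open MeasureTheory Filter Topology Finset Set
open Literature.Probability.LatticeModels

/-! ### Free = plus nearest-neighbour energies at every temperature in `d = 2` -/

/-- **In `d = 2`, `⟨σ_0σ_{eᵢ}⟩^∅_{β,0} = ⟨σ_0σ_{eᵢ}⟩⁺_{β,0}` for EVERY `β > 0`**: for `β ≤ β_c(2)` by uniqueness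
(`freeCorr_eq_plusCorr_of_le_criticalBeta`), for `β > β_c(2) = criticalBetaTwo` by BGJS eq. (3.10) (tree theorem
`twoPointFree_eq_twoPointPlus_of_criticalBetaTwo_lt_holds`, duality + Onsager; that branch alone is the tree's
`Literature.Probability.LatticeModels.nn_freeCorr_eq_plusCorr_two`). [cite: BenettinGallavottiJonaLasinioStella1973, eq. (3.10)] -/
theorem nn_freeCorr_eq_plusCorr_two_of_pos {β : ℝ} (hβ : 0 < β) (i : Fin 2) :
    freeCorr 2 β 0 {0, Pi.single i 1} = plusCorr 2 β 0 {0, Pi.single i 1} := by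
  rcases le_or_gt β (criticalBeta 2) with hle | hlt
  · exact freeCorr_eq_plusCorr_of_le_criticalBeta le_rfl hβ.le hle _
  · rw [← twoPointFree_eq_freeCorr β (unitVec_ne_zero i), ← twoPointPlus_eq_plusCorr β (unitVec_ne_zero i)]
    rw [criticalBeta_two_holds] at hlt
    exact twoPointFree_eq_twoPointPlus_of_criticalBetaTwo_lt_holds hlt _

/-! ### `ψ₂(·,0)` is `C¹` on `(0,∞)` -/

/-- **NO `β`-KINK AT ANY TEMPERATURE IN TWO DIMENSIONS**: for every `β > 0`, the zero-field pressure of the planar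
nearest-neighbour Ising model is differentiable in `β` with `∂ψ/∂β (β,0) = Σᵢ ⟨σ_0σ_{eᵢ}⟩⁺_β` (Lebowitz Thm. 2 with the
equality of the free and plus energies at every `β`). [cite: Lebowitz1977, §3, Thm. 2, p. 470; BenettinGallavottiJonaLasinioStella1973, eq. (3.10)] -/
theorem hasDerivAt_pressure_beta_two {β : ℝ} (hβ : 0 < β) :
    HasDerivAt (fun b => pressure 2 b 0) (∑ i, plusCorr 2 β 0 {0, Pi.single i 1}) β :=
  hasDerivAt_pressure_beta_of_nn_freeCorr_eq_plusCorr hβ (nn_freeCorr_eq_plusCorr_two_of_pos hβ)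

/-- `ψ₂(·,0)` is differentiable on `(0,∞)`. [cite: Lebowitz1977, §3, Thm. 2] -/
theorem differentiableOn_pressure_beta_two : DifferentiableOn ℝ (fun b => pressure 2 b 0) (Ioi 0) := fun _ hβ =>
  (hasDerivAt_pressure_beta_two hβ).differentiableAt.differentiableWithinAt

/-- `deriv ψ₂(·,0) β = Σᵢ ⟨σ_0σ_{eᵢ}⟩⁺_β` for every `β > 0`. [cite: Lebowitz1977, §3, Thm. 2] -/
theorem deriv_pressure_beta_two {β : ℝ} (hβ : 0 < β) :
    deriv (fun b => pressure 2 b 0) β = ∑ i, plusCorr 2 β 0 {0, Pi.single i 1} :=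
  (hasDerivAt_pressure_beta_two hβ).deriv

/-- **In `d = 2` the nearest-neighbour plus energy `b ↦ Σᵢ ⟨σ_0σ_{eᵢ}⟩⁺_b` is continuous at every `β > 0`**
(right-continuous always; equal on `(0,∞)` to the left-continuous free energy). [cite: FriedliVelenik2017, Exercise 3.16–3.17; BenettinGallavottiJonaLasinioStella1973, eq. (3.10)] -/
theorem continuousAt_sum_plusCorr_nn_two {β : ℝ} (hβ : 0 < β) :
    ContinuousAt (fun b => ∑ i : Fin 2, plusCorr 2 b 0 {0, Pi.single i 1}) β := by
  refine continuousAt_iff_continuous_left_right.2 ⟨?_, ?_⟩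
  · have hf : ContinuousWithinAt (fun b => ∑ i : Fin 2, freeCorr 2 b 0 {0, Pi.single i 1}) (Iic β) β :=
      tendsto_finsetSum _ fun i _ => (freeCorr_continuousWithinAt_Iic (d := 2) le_rfl {0, Pi.single i 1} hβ).tendsto
    refine hf.congr_of_eventuallyEq ?_ (sum_congr rfl fun i _ => (nn_freeCorr_eq_plusCorr_two_of_pos hβ i).symm)
    filter_upwards [Ioc_mem_nhdsLE hβ] with b hb
    exact sum_congr rfl fun i _ => (nn_freeCorr_eq_plusCorr_two_of_pos hb.1 i).symm
  · exact tendsto_finsetSum _ fun i _ => (plusCorr_continuousWithinAt_Ici (d := 2) le_rfl {0, Pi.single i 1} hβ.le).tendsto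

/-- **`ψ₂(·,0) ∈ C¹((0,∞))`**: the derivative `Σᵢ ⟨σ_0σ_{eᵢ}⟩⁺` is continuous on `(0,∞)` — the planar Ising energy density
is a continuous function of the temperature, through `β_c` and throughout the ordered phase.
[cite: Lebowitz1977, §3, Thm. 2; BenettinGallavottiJonaLasinioStella1973, eq. (3.10)] -/
theorem continuousOn_deriv_pressure_beta_two : ContinuousOn (deriv fun b => pressure 2 b 0) (Ioi 0) := by
  have hc : ContinuousOn (fun b => ∑ i : Fin 2, plusCorr 2 b 0 {0, Pi.single i 1}) (Ioi 0) := fun β hβ =>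
    (continuousAt_sum_plusCorr_nn_two hβ).continuousWithinAt
  exact hc.congr fun β hβ => deriv_pressure_beta_two hβ

/-! ### Translation invariant states have the plus energy at every `β > 0` -/

/-- **In `d = 2` every translation invariant Gibbs state has the plus nearest-neighbour energy, at EVERY `β > 0`**:
`⟨σ_xσ_{x+eᵢ}⟩_μ = ⟨σ_xσ_{x+eᵢ}⟩⁺_β` (`ψ₂(·,0)` is differentiable at `β`; Lebowitz Thm. 2). (For `β > β_c(2)` the tree's
`Literature.Probability.LatticeModels.translationInvariant_eq_mixture_two` gives the full mixture statement, Lebowitz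
Thm. 3; the differentiability route of `PressureBetaCoexistence` re-derives it and is not restated here.)
[cite: Lebowitz1977, §3, Thm. 2] -/
theorem nn_spinCorr_eq_plusCorr_two {β : ℝ} (hβ : 0 < β) {μ : Measure (SpinConfig (Site 2))}
    (hμG : μ ∈ isingGibbsMeasures 2 β 0) (hμT : IsTranslationInvariantMeasure μ) (x : Site 2) (i : Fin 2) :
    spinCorr μ {x, x + Pi.single i 1} = plusCorr 2 β 0 {x, x + Pi.single i 1} :=
  nn_spinCorr_eq_plusCorr_of_differentiableAt hβ (hasDerivAt_pressure_beta_two hβ).differentiableAt hμG hμT x i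

end IsingEnergyDensity

end Summit.CriticalPhenomena.PercolationContinuityZ3.Theorems.FK

end
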